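import Literature.Probability.FitznerVanDerHofstad2017.MeanFieldD11AppDStage1
import Literature.Probability.FitznerVanDerHofstad2017.MeanFieldOfTriangle
import HarnessLib

/-!
# Mean-field behaviour at `d = 11` on the kernel App.-D line, III: [FvdH17] Cor. 1.3 IN FULL (`MeanField 11`)

CITATION HEADER (PLACEMENT v2). This module is part of a certified REPRODUCTION of:
R. Fitzner, R. van der Hofstad, *Mean-field behavior for nearest-neighbor percolation in d > 10*,
Electron. J. Probab. 22 (2017), no. 43, 1–65 [FvdH17], and *Generalized approach to the non-backtracking
lace expansion*, Probab. Theory Related Fields 169 (2017), 1041–1119 [NoBLE17] (arXiv:1506.07977, 1506.07969).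
Reproduces: [FvdH17] Cor. 1.3 at `d = 11` — `θ(p_c) = 0`, `γ = 1`, `β = 1`, `δ = 2` (bounded-ratio sense) — in the
summit's own vocabulary `MeanField 11` (`MeanFieldExponents.lean`), for the two sentences of the kernel-proved
Appendix-D line: `D11.meanField_d11_appD` (`MeanFieldD11AppD.lean`, p185596: Assumption 4.3 at the literal records
`D11.inputsI` / `D11.inputsO`) and `D11.meanField_d11_typedStage1` (`MeanFieldD11AppDStage1.lean`, p185937: both
Assumption-4.3 hypotheses at the typed Stage-1 recipe's outputs with tails).  This is the App.-D-line analogue of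
`D11.meanField_d11_cert_full` (`OnPath.lean`, the record line `hI → hS → MeanField 11`): the passage triangle condition ⇒
exponents is the tree's `meanField_of_triangle` (`MeanFieldOfTriangle.lean`, `2 ≤ 11`); nothing numerical is added.
Build `lace`, LEAN TYPING SEAT 2 (gen 13), module 3 of the line.  ADDITIVE: the record files (`MeanFieldD11Cert` rev 6
p183353, `MeanFieldD11Inputs`, `NobleInstantiate`, `NobleAssumptions`) and modules 1–2 are untouched.

HYPOTHESES (displayed binders, exactly those of the two source sentences; none is a cited fact, none is minted here):
(S2a/S2a′) [NoBLE17] Assumption 4.3 at `p_I` and on `(p_I, p_c)` under `f ≤ Γ` — at the literal records (first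
theorem) or at the typed record cell with tails `Stage1Tails.Rec.inpMajQ CertD11.dataHi CertD11.P CertD11Rec.stateRec s SQr SbQr`
(second theorem); (S2b) [FvdH17] Prop. 2.2, the six weighted-diagram bounds `bi` / `bo`; (F) the App.-D F-side
inequality (D.3)+(D.32) at the published `β(inputsI)` / `β(inputsO)`.  LOGICAL NOTE: Assumption 4.3 is monotone along
`Inputs.Dom` (`NobleAssumption43At.of_dom`) and the typed record is dominated by the literal one, so the typed-record
hypothesis IMPLIES the literal one — the second theorem is the form that the analytic derivation of [FvdH17] §§4–6
(recipe validity, GAPS G8) discharges directly, not a logically weaker assumption.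
STATUS WORDING (REFEREE v49 W49.1): d = 11 — the bootstrap inequalities re-evaluated with certified arithmetic, Cert rev 6;
analytic hypotheses typed, see the headers of modules 1–2.  No sentence about any other dimension.

[cite: FitznerVanDerHofstad2017, Cor. 1.3 (EJP p. 6) and Prop. 2.4 (EJP p. 14), d = 11]
[cite: FitznerVanDerHofstad2016NoBLE, Def. 2.9, Thm 2.10, Prop. 2.11 (PTRF p. 1060); Assumption 4.3 (pp. 1086–1088); App. D]
-/

noncomputable section

namespace Literature.Probability.FitznerVanDerHofstad2017

open _root_.MeasureTheory _root_.Filter _root_.Topology Literature.Probability.LatticeModels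
open Literature.Barriers.CriticalPhenomena Literature.Probability.Percolation
open scoped BigOperators

namespace D11

open NoGoFrame Stage1Cells Stage1Cells.CertD11Rec
open Stage1Cells.CertD11 (P dataHi)
open Stage1Tails.Rec (inpMajQ)

/-- **[FvdH17] Cor. 1.3 at `d = 11` in full, App.-D line, literal records.**  `MeanField 11`
(`θ(p_c) = 0 ∧ γ = 1 ∧ β = 1 ∧ δ = 2`, bounded-ratio sense) from the hypotheses of `meanField_d11_appD`:
Assumption 4.3 at `p_I` for `inputsI` and on the window for `inputsO`, the F-side inequality at `β(inputsI)` /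
`β(inputsO)`, and the Prop. 2.2 weighted-diagram bounds `bi` / `bo`; exponents by `meanField_of_triangle`.
[cite: FitznerVanDerHofstad2017, Cor. 1.3 (d = 11), EJP p. 6] -/
theorem meanField_full_d11_appD
    (hI43 : NobleAssumption43At 11 (nbwThresholdI 11)
      (percolationNobleSplit 11 (nbwThresholdI 11) two_le_eleven (nbwThresholdI_lt_criticalProbI two_le_eleven)) inputsI)
    (hIF : ∀ k ∈ cube 11,
      ((BetaMap.nobleBetaOfInputs ((11 : ℕ) : ℝ) inputsI).αFlow - (BetaMap.nobleBetaOfInputs ((11 : ℕ) : ℝ) inputsI).βΔ) *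
        (1 - Dhat 11 k) ≤ cosFT (nobleF 11 (nbwThresholdI 11)) 0 - cosFT (nobleF 11 (nbwThresholdI 11)) k)
    (hIW : NobleWeightedDiagramBoundAt 11 (nbwThresholdI 11) bi)
    (hS : ∀ (p : unitInterval) (hp : p ∈ Set.Ioo (nbwThresholdI 11) (criticalProbI 11)),
      (∀ j, Literature.Barriers.CriticalPhenomena.nobleF 11 cMuC cWeightsC j p ≤ GammaC j) →
        NobleAssumption43At 11 p (percolationNobleSplit 11 p two_le_eleven hp.2) inputsO ∧
        (∀ k ∈ cube 11,
          ((BetaMap.nobleBetaOfInputs ((11 : ℕ) : ℝ) inputsO).αFlow -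
              (BetaMap.nobleBetaOfInputs ((11 : ℕ) : ℝ) inputsO).βΔ) * (1 - Dhat 11 k) ≤
            cosFT (nobleF 11 p) 0 - cosFT (nobleF 11 p) k) ∧
        NobleWeightedDiagramBoundAt 11 p bo) :
    MeanField 11 :=
  meanField_of_triangle (by norm_num) (meanField_d11_appD hI43 hIF hIW hS).1

/-- **[FvdH17] Cor. 1.3 at `d = 11` in full, App.-D line, typed Stage-1 record.**  `MeanField 11` from the
hypotheses of `meanField_d11_typedStage1`: Assumption 4.3 at `p_I` / on the window STATED AT THE TYPED STAGE-1 RECORD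
CELL WITH TAILS (`inpMajQ dataHi P stateRec .i / .o SQr SbQr`), the F-side inequality at the published `β(inputsI)` /
`β(inputsO)`, and the Prop. 2.2 bounds `bi` / `bo`; exponents by `meanField_of_triangle`.  SCOPE CAVEAT (REFEREE R288 (a)(iii) /
W51.1, inherited from `meanField_d11_typedStage1`): (S2a′) is stated at the Stage-1 cells AS CODED in `Percolation.nb` cells 1–44
(coded repulsive-polygon multiplicities; the D57 / N72(b) twins are NOT included — see `MeanFieldD11AppDStage1U` for the sentence at
the derivable-multiplicity twin); nothing here asserts that a coded cell bounds the lattice quantity it names.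
[cite: FitznerVanDerHofstad2017, Cor. 1.3 (d = 11), EJP p. 6] -/
theorem meanField_full_d11_typedStage1
    (hI43 : NobleAssumption43At 11 (nbwThresholdI 11)
      (percolationNobleSplit 11 (nbwThresholdI 11) two_le_eleven (nbwThresholdI_lt_criticalProbI two_le_eleven))
      (inpMajQ dataHi P stateRec .i SQr SbQr))
    (hIF : ∀ k ∈ cube 11,
      ((BetaMap.nobleBetaOfInputs ((11 : ℕ) : ℝ) inputsI).αFlow - (BetaMap.nobleBetaOfInputs ((11 : ℕ) : ℝ) inputsI).βΔ) *
        (1 - Dhat 11 k) ≤ cosFT (nobleF 11 (nbwThresholdI 11)) 0 - cosFT (nobleF 11 (nbwThresholdI 11)) k)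
    (hIW : NobleWeightedDiagramBoundAt 11 (nbwThresholdI 11) bi)
    (hS : ∀ (p : unitInterval) (hp : p ∈ Set.Ioo (nbwThresholdI 11) (criticalProbI 11)),
      (∀ j, Literature.Barriers.CriticalPhenomena.nobleF 11 cMuC cWeightsC j p ≤ GammaC j) →
        NobleAssumption43At 11 p (percolationNobleSplit 11 p two_le_eleven hp.2) (inpMajQ dataHi P stateRec .o SQr SbQr) ∧
        (∀ k ∈ cube 11,
          ((BetaMap.nobleBetaOfInputs ((11 : ℕ) : ℝ) inputsO).αFlow -
              (BetaMap.nobleBetaOfInputs ((11 : ℕ) : ℝ) inputsO).βΔ) * (1 - Dhat 11 k) ≤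
            cosFT (nobleF 11 p) 0 - cosFT (nobleF 11 p) k) ∧
        NobleWeightedDiagramBoundAt 11 p bo) :
    MeanField 11 :=
  meanField_of_triangle (by norm_num) (meanField_d11_typedStage1 hI43 hIF hIW hS).1

/-- The typed-record hypotheses imply the literal-record ones: from the binders of `meanField_d11_typedStage1`
one obtains those of `meanField_d11_appD` (Assumption 4.3 transported along `Inputs.Dom` by
`nobleAssumption43At_inputsO_of_stage1Full`; at `p_I` through the auxiliary record `inputsI2` the implication is
to `NobleAssumption43At … inputsI2`, `nobleAssumption43At_inputsI2_of_stage1Full`).  Window half, stated on its own.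
[cite: FitznerVanDerHofstad2016NoBLE, Assumption 4.3 (pp. 1086–1088)] -/
theorem window_inputsO_of_typedStage1
    (hS : ∀ (p : unitInterval) (hp : p ∈ Set.Ioo (nbwThresholdI 11) (criticalProbI 11)),
      (∀ j, Literature.Barriers.CriticalPhenomena.nobleF 11 cMuC cWeightsC j p ≤ GammaC j) →
        NobleAssumption43At 11 p (percolationNobleSplit 11 p two_le_eleven hp.2) (inpMajQ dataHi P stateRec .o SQr SbQr) ∧
        (∀ k ∈ cube 11,
          ((BetaMap.nobleBetaOfInputs ((11 : ℕ) : ℝ) inputsO).αFlow -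
              (BetaMap.nobleBetaOfInputs ((11 : ℕ) : ℝ) inputsO).βΔ) * (1 - Dhat 11 k) ≤
            cosFT (nobleF 11 p) 0 - cosFT (nobleF 11 p) k) ∧
        NobleWeightedDiagramBoundAt 11 p bo) :
    ∀ (p : unitInterval) (hp : p ∈ Set.Ioo (nbwThresholdI 11) (criticalProbI 11)),
      (∀ j, Literature.Barriers.CriticalPhenomena.nobleF 11 cMuC cWeightsC j p ≤ GammaC j) →
        NobleAssumption43At 11 p (percolationNobleSplit 11 p two_le_eleven hp.2) inputsO ∧
        (∀ k ∈ cube 11,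
          ((BetaMap.nobleBetaOfInputs ((11 : ℕ) : ℝ) inputsO).αFlow -
              (BetaMap.nobleBetaOfInputs ((11 : ℕ) : ℝ) inputsO).βΔ) * (1 - Dhat 11 k) ≤
            cosFT (nobleF 11 p) 0 - cosFT (nobleF 11 p) k) ∧
        NobleWeightedDiagramBoundAt 11 p bo := by
  intro p hp hf
  obtain ⟨h43, hF, hW⟩ := hS p hp hf
  exact ⟨nobleAssumption43At_inputsO_of_stage1Full h43, hF, hW⟩

end D11

end Literature.Probability.FitznerVanDerHofstad2017

end
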